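import Literature.MathematicalPhysics.QuantumFieldTheory.Balaban1983to89.B3Op116LeibnizRows

/-!
# Bałaban, *(Higgs)₂,₃ quantum fields in a finite volume III. Renormalization* [B3] — THE OPERATOR (1.16) p. 414 ON A REGION
`Ω ⊆ T_ε`: PRINT'S SUPPORT HYPOTHESIS «dist(supp Ã, ∂Ω) > 2r(L^kε)» (p. 412) MAKES `V_k(Ã,B̃)` VANISH OFF THE `R₀`-INTERIOR, SO THE
SOURCE ROWS OF `V_k(Ã,B̃)w` ONLY READ INTERIOR POINTS — file R1 of the region twin of the cell's (1.16) programme (the Leibniz rows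
of FILE 4α `B3Op116LeibnizRows` with every site/bond function TRUNCATED to the interior of `Ω`)

statement-level skeleton of published theorems with citation tags; proofs where landed; nothing here is a claim about the Yang–Mills mass gap

T. Bałaban, Commun. Math. Phys. **88** (1983) 411–445 [cite: Balaban1983Higgs3]; part I, Commun. Math. Phys. **85** (1982) 603–636
[cite: Balaban1982Higgs1]; [B4] = Commun. Math. Phys. **89** (1983) 571–597 [cite: Balaban1983RegularityDecay].  PDFs held:
`paper:balaban1983-higgs-2-3-quantum-fields-finite-volume` (journal page = PDF page + 410; p. 412 = `p0002.txt`, p. 414 = `p0004.txt`,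
p. 426 = `p0016.txt`), `paper:balaban1983-cmp89-regularity-decay` (p. 573 = `p0003.txt`).

CITATION HEADER (lean-in-tree rule).  Cell `lit-balaban` (HOME `run/shared/lean/pub/lit-balaban/`), Phase-2 proof seat **p40** gen 75
(unit `lit-balaban-p40`; TAKING line HOME/STATUS.md 2026-08-23T09:21:23Z: B3-CLOSURE.md §5 item 20 «region twin of the (1.16) branch of
(2.5)», owner r15, lead g12 word 2026-08-23T08:58:08Z).  SKELETON rows **B3.Eq1.16** (analytic half) / **B3.Eq2.5** (fold owner r15) —
LOCATED MEMBER, no head claim.  USED BY NAME, never restated: p40 g70 `B3Op116SourceForm`-side objects of r14 (`srcV`, `srcMD`, `srcDM`,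
`srcMM`, `bondSrc`, `avgSrc`, `map_srcV`, `norm_mapE_single_le`, `norm_mapE_srcMD_le`, `norm_mapE_srcMM_le`, `norm_mapE_le_sum_norm_mul_col`),
p40 `B3Op116Pieces` (`fOne`, `mulM`, `fTwo`, `fTwoAdj`, `fTwo_apply`, `fTwoAdj_apply`, `norm_fTwo_apply_le`, `norm_fTwoAdj_apply_le`), p35
`B3Op116LeibnizRows` (`pred`, `nMul`, THEOREM A′ `inv_smul_sum_srcDM_eq`, `map_srcV_univ_leibniz`, `norm_nMul_apply_le`), r14
`B3Ineq210RegularRegion.Interior` (the `R₀`-clause of Prop. I.2.1 / [B4] Thm p. 573), r14 `B3Op116KernelRegularTorus.norm_avgQkLin_apply_le_block`,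
r02 `B2Ineq329PrismHolonomy.{abs_multiContourSum_le, blockIter_stair_src}`.

## What is printed

[B3] p. 412 [PDF 2] (verbatim): *"Let us write the corresponding expansion for the expressions in (1.5) with A^{(k)} replaced by A + B
and the expansion taken with respect to A, where A and B are quite general fields satisfying some regularity conditions. More precisely we
will assume |A|, |∂^ηA|, |∂^ηB| and their Hölder norms with exponent α₀ are ≦ O(1)p(L^kε) and dist(supp A, ∂Ω) > 2r(L^kε)."*
[B3] p. 414 [PDF 4]: *"[G_k(Ω,B̃)V_k(Ã,B̃)]^n G_k(Ω,Ã+B̃)[V_k(Ã,B̃)G_k(Ω,B̃)]^{n′}, (1.16) … for n, n′ sufficiently large, a kernel of the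
operator (1.16) is a sufficiently regular function of both variables. … This estimate follows easily from the properties of the propagators
G_k(Ω,A) proved in the next paper."*  [B4] p. 573 [PDF 3], the Theorem: (1.9)/(1.10) hold *"for x, x′ ∈ Ω, and satisfying the condition
dist({x,x′},Ωᶜ) ≧ R₀ … For some simple sets Ω, e.g. for rectangular parallelepipeds, the inequalities hold without any restrictions on the
points x, x′"*.  [B3] (2.10) p. 426 [PDF 16] for `G^η_{(j)}(Ω,B̃;x,x′)`.

## Why this file (the region obstruction and its resolution inside print)

The cited source of the (1.16) estimate gives the kernel bounds of `G_k(Ω,·)` for a general big-block union `Ω` ONLY at `R₀`-interior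
points (the tree: r14's `Interior k K₀ Ω`, carrier `regRegionKernels … Ω …` of `B3Ineq210RegularRegion`), while the kernel of (1.16) at an
interior pair `(x,x′)` sums the `Ω`-propagators over all intermediate points; and the Leibniz rearrangement of the dipole sources
(`B3Op116LeibnizRows`, THEOREM A′) is a torus identity.  Both are resolved by print's hypothesis p. 412: `Ã` vanishes off a deep set, hence
the bond multipliers `M_b = ε⁻¹U(εB̃_b)(U(εÃ_b) − 1)` (`mulM_eq_zero`), their adjoints, the three bond sources, the difference multipliers
`N_b`, the contour holonomies `U(Ã(Γ^{(k)}_{y,x})) − 1` of blocks not meeting `supp Ã` (`multiContourSum_eq_zero_of_not_deep`) and the averaging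
sources `F_{2,k}`, `F_{2,k}^*` (`fTwo_apply_eq_zero`, `fTwoAdj_apply_eq_zero`, `avgSrc_apply_eq_zero`) ALL VANISH outside the deep set; so
`Σ_{b⊂Ω} = Σ_{b∈T_ε}` for the bond part (`srcV_region_eq_univ`: `V_k` of the region equals the torus expression on every field) and THEOREM A′
applies verbatim — NO boundary term.

## What this file proves

§1 `DeepBlk k K₀ Ω y` («every site of the `k`-block of `y` and each of its lattice neighbours is an `Interior` point») and its closure
properties.  §2 under the SUPPORT HYPOTHESIS `hAS : ∀ b, Ã_b ≠ 0 → DeepBlk b₋ ∧ DeepBlk b₊` (print's «dist(supp A, ∂Ω) > 2r(L^kε)» read with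
the tree's margin): the vanishing lemmas listed above and `srcV … Ω … w = srcV … T_ε … w`.  §3 the truncations `cutV` (values at interior
sites), `cutD` (covariant derivatives at bonds from interior sites), `cutK` (the column `Σ_i‖Te_{(y,i)}‖` of a linear `T` at interior sites),
with their (in)equations.  §4 **THE L-FORM ROW OF `V_k(Ã,B̃)w` ON A REGION** (`norm_mapE_srcV_region_le`): for every vector-valued linear `T`,
`‖T(V_k^Ω w)‖ ≤ Σ_b[|e|s·D′(b)κ′_T(b₊) + (ε⁻¹|e|δ_A·W′(b₋) + |e|s·D′(b))κ′_T(b₋) + (|e|s)²W′(b₊)κ′_T(b₊)] + |a_k|(L^kε)^{−2}m(2+m)Σ_y κ′_T(y)L^{−kd}Σ_{x∈B^k(ȳ)}W′(x)`,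
`m = |e|sεd(L^k−1)`, with the TRUNCATED functions `W′ = cutV w`, `D′ = cutD w`, `κ′_T = cutK T` — i.e. EXACTLY the input shape of p35's abstract
`B3Op116MajorantStep.row_step_le`, so that FILE 4β₂'s step runs on a region with states controlled at interior points only (file R2
`B3Op116DKernelRegularRegion`).

## Honest scope

Identities and triangle-inequality bounds only; no decay, no scale sums.  `Ã = A` vanishes on every bond not having both endpoints in deep
blocks — this is print's p. 412 hypothesis with `2r(L^kε)` replaced by the tree's `Interior` margin `2r_S + 2L^kK₀(d+1) + 1` fine sites plus one
`k`-block and one bond (a declared reading: print's logarithmic margin is larger for small `L^kε`); `sup_b|A_b| ≤ s` and the (I.2.23)-shape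
regularity `δ_A` stay global hypotheses as in FILE 4α; `k ≤ K` (block contours).  Nothing is claimed at non-interior points and nothing about
regions without the support hypothesis (p35 DESIGN-FILE4 §12(b): there the Leibniz rearrangement has face terms).  Concrete `def`s (`DeepBlk`,
`cutV`, `cutD`, `cutK`); no `def … : Prop` fact, no new named fact; axioms standard.  Value = located engine of a by-reference step of B3 at
print's generality (regions), NOT summit progress.
-/

noncomputable section

open scoped BigOperators InnerProductSpace

namespace Literature.MathematicalPhysics.QuantumFieldTheory.Balaban1983to89.B3Op116RegionSources

open HiggsLattice (ChargeData ScalarField covDeriv)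
open HiggsCovariance (propagatorK avgQkLin avgQkAdj E)
open HiggsCovariancePos (Inside shift_unshift unshift_shift)
open HiggsAveraging (blockK blockIter mem_blockK multiContourSum toFinest)
open B1Eq230FluctCov (Ix cb)
open B1Ineq234LevelZero (tdist_shift_le_one tdist_comm tdist_triangle_real)
open B1Ineq234Concrete (tdist_self)
open B3Ineq210RegularRegion (Interior)
open B3Ineq210MixedRegularTorus (dip dip_zero)
open B3Op116Pieces (fOne fOne_apply mulM mulM_apply fTwo fTwoAdj fTwo_apply fTwoAdj_apply norm_fTwo_apply_le norm_fTwoAdj_apply_le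
  norm_U_apply)
open B3Op116SourceForm (mulMT srcV srcMD srcDM srcMM bondSrc avgSrc map_srcV norm_mapE_single_le norm_mapE_srcMD_le norm_mapE_srcMM_le
  norm_mapE_le_sum_norm_mul_col)
open B3Op116LeibnizRows (pred pred_tgt nMul nMul_apply inv_smul_sum_srcDM_eq map_srcV_univ_leibniz norm_nMul_apply_le)
open B3Op116KernelRegularTorus (norm_avgQkLin_apply_le_block)
open B2Ineq329PrismHolonomy (abs_multiContourSum_le blockIter_stair_src)

variable {P : HiggsLattice.Params} {N : ℕ}

/-! ## §1 Deep blocks of a region -/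

section Deep

variable {k K₀ : ℕ} {Ω : Finset (HiggsLattice.Site P 0)}

/-- **Deep blocks**: the site `y` lies in a `k`-block ALL of whose sites, together with their lattice neighbours, are `Interior` points of `Ω`
(r14's `R₀`-margin of Prop. I.2.1 / [B4] p. 573) — the set on which print's support hypothesis «dist(supp A, ∂Ω) > 2r(L^kε)» (p. 412)
places the bonds of `supp Ã`. [cite: Balaban1983Higgs3, p.412] [cite: Balaban1983RegularityDecay, Theorem p.573] -/
def DeepBlk (k K₀ : ℕ) (Ω : Finset (HiggsLattice.Site P 0)) (y : HiggsLattice.Site P 0) : Prop :=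
  ∀ z : HiggsLattice.Site P 0, blockIter k z = blockIter k y →
    ∀ z' : HiggsLattice.Site P 0, HiggsLattice.Site.tdist z z' ≤ 1 → Interior k K₀ Ω z'

/-- A deep site is an interior point. [cite: Balaban1983Higgs3, p.412] -/
theorem DeepBlk.interior {y : HiggsLattice.Site P 0} (h : DeepBlk k K₀ Ω y) : Interior k K₀ Ω y :=
  h y rfl y (by rw [tdist_self]; exact Nat.zero_le _)

/-- The forward neighbours of a deep site are interior points. [cite: Balaban1983Higgs3, p.412] -/
theorem DeepBlk.interior_shift {y : HiggsLattice.Site P 0} (h : DeepBlk k K₀ Ω y) (μ : Fin P.d) : Interior k K₀ Ω (y.shift μ) :=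
  h y rfl _ (tdist_shift_le_one y μ)

/-- The backward neighbours of a deep site are interior points. [cite: Balaban1983Higgs3, p.412] -/
theorem DeepBlk.interior_unshift {y : HiggsLattice.Site P 0} (h : DeepBlk k K₀ Ω y) (μ : Fin P.d) :
    Interior k K₀ Ω (y.unshift μ) := by
  refine h y rfl _ ?_
  have h1 := tdist_shift_le_one (y.unshift μ) μ
  rw [shift_unshift] at h1
  rwa [tdist_comm]

/-- `DeepBlk` is a property of the `k`-block. [cite: Balaban1983Higgs3, p.412] -/
theorem DeepBlk.of_blockIter_eq {y z : HiggsLattice.Site P 0} (h : DeepBlk k K₀ Ω y) (hz : blockIter k z = blockIter k y) :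
    DeepBlk k K₀ Ω z :=
  fun u hu => h u (hu.trans hz)

/-- Every site of the block of a deep site is an interior point. [cite: Balaban1983Higgs3, p.412] -/
theorem DeepBlk.interior_of_mem_blockK {y z : HiggsLattice.Site P 0} (h : DeepBlk k K₀ Ω y) (hz : z ∈ blockK k (blockIter k y)) :
    Interior k K₀ Ω z :=
  (h.of_blockIter_eq ((mem_blockK k _ z).1 hz)).interior

/-- A deep site lies in `Ω`. [cite: Balaban1983Higgs3, p.412] -/
theorem DeepBlk.mem {y : HiggsLattice.Site P 0} (h : DeepBlk k K₀ Ω y) : y ∈ Ω := h.interior.mem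

end Deep

/-! ## §2 The support hypothesis: all sources of `V_k(Ã,B̃)` vanish off the deep set -/

section Vanish

variable (C : ChargeData N) (A B : HiggsLattice.VecField P 0)

/-- **`M_b = 0` on a bond where `Ã_b = 0`** (`F₁(0) = 0` since `U(0) = 1`; r14's `B2Eq268DerivHiggsRegion.fOne_zero` states the latter —
not imported here, to keep the B2 (2.68) files out of the import cone of the (1.16) chain). [cite: Balaban1982Higgs1, (3.14) p.614] [cite: Balaban1983Higgs3, p.412] -/
theorem mulM_eq_zero {b : HiggsLattice.PBond P 0} (h : A b = 0) : mulM C A B b = 0 := by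
  ext v
  simp [mulM_apply, h, fOne_apply, ChargeData.U_zero]

/-- `M_b^* = 0` where `Ã_b = 0`. [cite: Balaban1982Higgs1, (3.16) p.615] [cite: Balaban1983Higgs3, p.412] -/
theorem mulMT_eq_zero {b : HiggsLattice.PBond P 0} (h : A b = 0) : mulMT C A B b = 0 := by
  rw [mulMT, mulM_eq_zero C A B h, map_zero]

/-- The `M^*D` source of a bond with `Ã_b = 0` vanishes. [cite: Balaban1982Higgs1, (3.16) p.615] [cite: Balaban1983Higgs3, p.412] -/
theorem srcMD_eq_zero {b : HiggsLattice.PBond P 0} (h : A b = 0) (w : ScalarField P 0 N) : srcMD C A B b w = 0 := by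
  rw [srcMD, mulMT_eq_zero C A B h, _root_.zero_apply, Pi.single_zero]

/-- The `D^*M` source of a bond with `Ã_b = 0` vanishes. [cite: Balaban1982Higgs1, (3.16) p.615] [cite: Balaban1983Higgs3, p.412] -/
theorem srcDM_eq_zero {b : HiggsLattice.PBond P 0} (h : A b = 0) (w : ScalarField P 0 N) : srcDM C A B b w = 0 := by
  rw [srcDM, mulM_eq_zero C A B h, _root_.zero_apply, dip_zero]

/-- The `M^*M` source of a bond with `Ã_b = 0` vanishes. [cite: Balaban1982Higgs1, (3.16) p.615] [cite: Balaban1983Higgs3, p.412] -/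
theorem srcMM_eq_zero {b : HiggsLattice.PBond P 0} (h : A b = 0) (w : ScalarField P 0 N) : srcMM C A B b w = 0 := by
  rw [srcMM, mulM_eq_zero C A B h, _root_.zero_apply, map_zero, Pi.single_zero]

/-- The three bond sources of a bond with `Ã_b = 0` vanish. [cite: Balaban1982Higgs1, (3.16) p.615] [cite: Balaban1983Higgs3, p.412] -/
theorem bondSrc_eq_zero {b : HiggsLattice.PBond P 0} (h : A b = 0) (w : ScalarField P 0 N) : bondSrc C A B b w = 0 := by
  rw [bondSrc, srcMD_eq_zero C A B h, srcDM_eq_zero C A B h, srcMM_eq_zero C A B h, smul_zero, add_zero, add_zero]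

/-- The difference multiplier `N_b` vanishes when `Ã` vanishes on `b` and on the preceding collinear bond. [cite: Balaban1982Higgs1, (3.14) p.614] [cite: Balaban1983Higgs3, p.412] -/
theorem nMul_eq_zero {b : HiggsLattice.PBond P 0} (h1 : A (pred b) = 0) (h2 : A b = 0) : nMul C A b = 0 := by
  rw [nMul, h1, h2, sub_self, smul_zero]

variable {k K₀ : ℕ} {Ω : Finset (HiggsLattice.Site P 0)}

/-- **The contour holonomy exponent `Ã(Γ^{(k)}_{ȳ,x})` vanishes when `Ã` vanishes on every bond starting in the `k`-block of `x`**
(the staircase contours stay in the block, r02's `blockIter_stair_src`; `k ≤ K`). [cite: Balaban1982Higgs1, (2.2) p.608] [cite: Balaban1983Higgs3, p.412] -/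
theorem multiContourSum_eq_zero (hk : k ≤ P.K) {x : HiggsLattice.Site P 0}
    (h : ∀ b : HiggsLattice.PBond P 0, blockIter k b.src = blockIter k x → A b = 0) : multiContourSum A k x = 0 := by
  have hb := abs_multiContourSum_le A k x (β := 0) (fun i hi ν s hs => by
    rw [h _ (blockIter_stair_src hi hk x ν hs), abs_zero])
  rw [mul_zero] at hb
  exact abs_nonpos_iff.1 hb

variable (hAS : ∀ b : HiggsLattice.PBond P 0, A b ≠ 0 → DeepBlk k K₀ Ω b.src ∧ DeepBlk k K₀ Ω b.tgt)
include hAS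

/-- Under the support hypothesis: `Ã_b = 0` unless `b₋` is deep. [cite: Balaban1983Higgs3, p.412] -/
theorem apply_eq_zero_of_not_deep_src {b : HiggsLattice.PBond P 0} (hb : ¬ DeepBlk k K₀ Ω b.src) : A b = 0 := by
  by_contra h; exact hb (hAS b h).1

/-- Under the support hypothesis: `Ã_b = 0` unless `b₊` is deep. [cite: Balaban1983Higgs3, p.412] -/
theorem apply_eq_zero_of_not_deep_tgt {b : HiggsLattice.PBond P 0} (hb : ¬ DeepBlk k K₀ Ω b.tgt) : A b = 0 := by
  by_contra h; exact hb (hAS b h).2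

/-- Under the support hypothesis: `Ã_{b−e_μ} = 0` unless `b₋ = (b − e_μ)₊` is deep. [cite: Balaban1983Higgs3, p.412] -/
theorem apply_pred_eq_zero_of_not_deep_src {b : HiggsLattice.PBond P 0} (hb : ¬ DeepBlk k K₀ Ω b.src) : A (pred b) = 0 := by
  refine apply_eq_zero_of_not_deep_tgt A hAS ?_
  rwa [pred_tgt]

/-- Under the support hypothesis (`k ≤ K`): the block holonomy exponent of `Ã` vanishes at every site of a block that is not deep.
[cite: Balaban1982Higgs1, (2.2) p.608] [cite: Balaban1983Higgs3, p.412] -/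
theorem multiContourSum_eq_zero_of_not_deep (hk : k ≤ P.K) {x : HiggsLattice.Site P 0} (hx : ¬ DeepBlk k K₀ Ω x) :
    multiContourSum A k x = 0 := by
  refine multiContourSum_eq_zero A hk fun b hb => apply_eq_zero_of_not_deep_src A hAS fun hd => hx ?_
  exact hd.of_blockIter_eq hb.symm

/-- **`(F_{2,k}(Ã,B̃)w)(ȳ) = 0` on a block that is not deep** (`k ≤ K`). [cite: Balaban1982Higgs1, (3.15) p.614] [cite: Balaban1983Higgs3, p.412] -/
theorem fTwo_apply_eq_zero (hk : k ≤ P.K) {x : HiggsLattice.Site P 0} (hx : ¬ DeepBlk k K₀ Ω x) (w : ScalarField P 0 N) :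
    fTwo C A B k w (blockIter k x) = 0 := by
  rw [fTwo_apply]
  refine smul_eq_zero_of_right _ (Finset.sum_eq_zero fun z hz => ?_)
  have hz' : ¬ DeepBlk k K₀ Ω z := fun hd => hx (hd.of_blockIter_eq ((mem_blockK k _ z).1 hz).symm)
  rw [multiContourSum_eq_zero_of_not_deep A hAS hk hz', ChargeData.U_zero, one_apply_eq_self, sub_self]

/-- **`(F_{2,k}(Ã,B̃)^*ψ)(x) = 0` at a site whose block is not deep** (`k ≤ K`). [cite: Balaban1982Higgs1, (3.16) p.615] [cite: Balaban1983Higgs3, p.412] -/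
theorem fTwoAdj_apply_eq_zero (hk : k ≤ P.K) {x : HiggsLattice.Site P 0} (hx : ¬ DeepBlk k K₀ Ω x) (ψ : ScalarField P k N) :
    fTwoAdj C A B k ψ x = 0 := by
  rw [fTwoAdj_apply, multiContourSum_eq_zero_of_not_deep A hAS hk hx, neg_zero, ChargeData.U_zero,
    one_apply_eq_self, sub_self, map_zero]

/-- **The averaging sources vanish at every site whose block is not deep** (`k ≤ K`). [cite: Balaban1982Higgs1, (3.16) p.615] [cite: Balaban1983Higgs3, p.412] -/
theorem avgSrc_apply_eq_zero (hk : k ≤ P.K) {x : HiggsLattice.Site P 0} (hx : ¬ DeepBlk k K₀ Ω x) (w : ScalarField P 0 N) :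
    avgSrc C A B k w x = 0 := by
  rw [avgSrc, Pi.add_apply, Pi.add_apply, fTwoAdj_apply_eq_zero C A B hAS hk hx, fTwoAdj_apply_eq_zero C A B hAS hk hx, zero_add,
    add_zero]
  have h : ‖avgQkAdj C B k (fTwo C A B k w) x‖ = 0 := by
    rw [B3Ineq210RegularTorus.norm_avgQkAdj_apply', fTwo_apply_eq_zero C A B hAS hk hx, norm_zero]
  exact norm_eq_zero.1 h

/-- The Leibniz charge of THEOREM A′ vanishes at a bond whose initial point is not deep. [cite: Balaban1982Higgs1, (3.16) p.615] [cite: Balaban1983Higgs3, p.412] -/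
theorem leibnizCharge_eq_zero {b : HiggsLattice.PBond P 0} (hb : ¬ DeepBlk k K₀ Ω b.src) (w : ScalarField P 0 N) :
    nMul C A b (w b.src) - fOne C (P.mesh 0) (A b) (covDeriv C B w b) = 0 := by
  have hf : fOne C (P.mesh 0) 0 = 0 := by ext v; simp [fOne_apply, ChargeData.U_zero]
  rw [nMul_eq_zero C A (apply_pred_eq_zero_of_not_deep_src A hAS hb) (apply_eq_zero_of_not_deep_src A hAS hb),
    apply_eq_zero_of_not_deep_src A hAS hb, hf, _root_.zero_apply, _root_.zero_apply, sub_self]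

/-- A bond carrying `Ã` lies inside `Ω`. [cite: Balaban1983Higgs3, p.412] -/
theorem inside_of_apply_ne_zero {b : HiggsLattice.PBond P 0} (h : A b ≠ 0) : Inside Ω b :=
  ⟨(hAS b h).1.mem, (hAS b h).2.mem⟩

/-- **`V_k(Ã,B̃)` OF THE REGION IS THE TORUS EXPRESSION** under the support hypothesis: `srcV … Ω … w = srcV … T_ε … w` for every field `w`
(the bond sum `Σ_{b⊂Ω}` loses nothing: bonds not inside `Ω` carry no `Ã`; the averaging part does not see `Ω`).
[cite: Balaban1982Higgs1, (3.16) p.615] [cite: Balaban1983Higgs3, (1.16) p.414, p.412] -/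
theorem srcV_region_eq_univ (a : ℝ) (w : ScalarField P 0 N) : srcV C A B k Ω a w = srcV C A B k Finset.univ a w := by
  unfold srcV
  congr 2
  refine Finset.sum_congr rfl fun b _ => ?_
  have hu : Inside (Finset.univ : Finset (HiggsLattice.Site P 0)) b := ⟨Finset.mem_univ _, Finset.mem_univ _⟩
  rw [if_pos hu]
  split_ifs with hb
  · rfl
  · by_cases h : A b = 0
    · rw [bondSrc_eq_zero C A B h]
    · exact absurd (inside_of_apply_ne_zero A hAS h) hb

end Vanish

/-! ## §3 Truncations to the interior -/

section Cut

open scoped Classical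

variable (k K₀ : ℕ) (Ω : Finset (HiggsLattice.Site P 0))

/-- the values of a field at INTERIOR sites (zero elsewhere): the only values the region chain controls. [cite: Balaban1983RegularityDecay, Theorem p.573] [cite: Balaban1983Higgs3, (2.10) p.426] -/
def cutV (w : ScalarField P 0 N) (z : HiggsLattice.Site P 0) : ℝ :=
  if Interior k K₀ Ω z then ‖w z‖ else 0

/-- the covariant derivatives of a field at bonds from INTERIOR sites (zero elsewhere). [cite: Balaban1983RegularityDecay, Theorem p.573] [cite: Balaban1983Higgs3, (2.10) p.426] -/
def cutD (C : ChargeData N) (B : HiggsLattice.VecField P 0) (w : ScalarField P 0 N) (b : HiggsLattice.PBond P 0) : ℝ :=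
  if Interior k K₀ Ω b.src then ‖covDeriv C B w b‖ else 0

variable {M' : Type*} [NormedAddCommGroup M'] [NormedSpace ℝ M']

/-- the column `κ_T(z) = Σ_i‖Te_{(z,i)}‖` of a linear `T` at INTERIOR sites (zero elsewhere). [cite: Balaban1983RegularityDecay, Theorem p.573] [cite: Balaban1983Higgs3, (2.10) p.426] -/
def cutK (T : ScalarField P 0 N →ₗ[ℝ] M') (z : HiggsLattice.Site P 0) : ℝ :=
  if Interior k K₀ Ω z then ∑ i : Ix N, ‖T (cb P N 0 (z, i))‖ else 0

variable {k K₀ Ω}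

/-- at an interior site the truncated value is the value. [cite: Balaban1983Higgs3, (2.10) p.426] -/
theorem cutV_of_interior (w : ScalarField P 0 N) {z : HiggsLattice.Site P 0} (hz : Interior k K₀ Ω z) : cutV k K₀ Ω w z = ‖w z‖ := by
  rw [cutV, if_pos hz]

/-- off the interior the truncated value is `0`. [cite: Balaban1983Higgs3, (2.10) p.426] -/
theorem cutV_of_not_interior (w : ScalarField P 0 N) {z : HiggsLattice.Site P 0} (hz : ¬ Interior k K₀ Ω z) : cutV k K₀ Ω w z = 0 := by
  rw [cutV, if_neg hz]

/-- `cutV ≥ 0`. [cite: Balaban1983Higgs3, (2.10) p.426] -/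
theorem cutV_nonneg (w : ScalarField P 0 N) (z : HiggsLattice.Site P 0) : 0 ≤ cutV k K₀ Ω w z := by
  unfold cutV; split_ifs
  · exact norm_nonneg _
  · exact le_rfl

/-- a bound at interior sites by a nonnegative function is a bound of `cutV` everywhere. [cite: Balaban1983Higgs3, (2.10) p.426] -/
theorem cutV_le_of (w : ScalarField P 0 N) {g : HiggsLattice.Site P 0 → ℝ} (hg : ∀ z, 0 ≤ g z)
    (h : ∀ z, Interior k K₀ Ω z → ‖w z‖ ≤ g z) (z : HiggsLattice.Site P 0) : cutV k K₀ Ω w z ≤ g z := by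
  unfold cutV; split_ifs with hz
  · exact h z hz
  · exact hg z

/-- at a bond from an interior site the truncated derivative is the derivative. [cite: Balaban1983Higgs3, (2.10) p.426] -/
theorem cutD_of_interior (C : ChargeData N) (B : HiggsLattice.VecField P 0) (w : ScalarField P 0 N) {b : HiggsLattice.PBond P 0}
    (hb : Interior k K₀ Ω b.src) : cutD k K₀ Ω C B w b = ‖covDeriv C B w b‖ := by
  rw [cutD, if_pos hb]

/-- `cutD ≥ 0`. [cite: Balaban1983Higgs3, (2.10) p.426] -/
theorem cutD_nonneg (C : ChargeData N) (B : HiggsLattice.VecField P 0) (w : ScalarField P 0 N) (b : HiggsLattice.PBond P 0) :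
    0 ≤ cutD k K₀ Ω C B w b := by
  unfold cutD; split_ifs
  · exact norm_nonneg _
  · exact le_rfl

/-- a bound at bonds from interior sites by a nonnegative function is a bound of `cutD` everywhere. [cite: Balaban1983Higgs3, (2.10) p.426] -/
theorem cutD_le_of (C : ChargeData N) (B : HiggsLattice.VecField P 0) (w : ScalarField P 0 N) {g : HiggsLattice.PBond P 0 → ℝ}
    (hg : ∀ b, 0 ≤ g b) (h : ∀ b, Interior k K₀ Ω b.src → ‖covDeriv C B w b‖ ≤ g b) (b : HiggsLattice.PBond P 0) :
    cutD k K₀ Ω C B w b ≤ g b := by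
  unfold cutD; split_ifs with hb
  · exact h b hb
  · exact hg b

/-- at an interior site the truncated column is the column. [cite: Balaban1983Higgs3, (2.10) p.426] -/
theorem cutK_of_interior (T : ScalarField P 0 N →ₗ[ℝ] M') {z : HiggsLattice.Site P 0} (hz : Interior k K₀ Ω z) :
    cutK k K₀ Ω T z = ∑ i : Ix N, ‖T (cb P N 0 (z, i))‖ := by
  rw [cutK, if_pos hz]

/-- off the interior the truncated column is `0`. [cite: Balaban1983Higgs3, (2.10) p.426] -/
theorem cutK_of_not_interior (T : ScalarField P 0 N →ₗ[ℝ] M') {z : HiggsLattice.Site P 0} (hz : ¬ Interior k K₀ Ω z) :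
    cutK k K₀ Ω T z = 0 := by
  rw [cutK, if_neg hz]

/-- `cutK ≥ 0`. [cite: Balaban1983Higgs3, (2.10) p.426] -/
theorem cutK_nonneg (T : ScalarField P 0 N →ₗ[ℝ] M') (z : HiggsLattice.Site P 0) : 0 ≤ cutK k K₀ Ω T z := by
  unfold cutK; split_ifs
  · exact Finset.sum_nonneg fun _ _ => norm_nonneg _
  · exact le_rfl

/-- a bound of the column at interior sites by a nonnegative function is a bound of `cutK` everywhere. [cite: Balaban1983Higgs3, (2.10) p.426] -/
theorem cutK_le_of (T : ScalarField P 0 N →ₗ[ℝ] M') {g : HiggsLattice.Site P 0 → ℝ} (hg : ∀ z, 0 ≤ g z)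
    (h : ∀ z, Interior k K₀ Ω z → ∑ i : Ix N, ‖T (cb P N 0 (z, i))‖ ≤ g z) (z : HiggsLattice.Site P 0) : cutK k K₀ Ω T z ≤ g z := by
  unfold cutK; split_ifs with hz
  · exact h z hz
  · exact hg z

end Cut

/-! ## §4 The L-form row of `V_k(Ã,B̃)w` on a region, through a vector-valued linear functional, truncated to the interior -/

section Row

variable (C : ChargeData N) (A B : HiggsLattice.VecField P 0) (a : ℝ) (k : ℕ) {K₀ : ℕ} {Ω : Finset (HiggsLattice.Site P 0)}
variable {M' : Type*} [NormedAddCommGroup M'] [NormedSpace ℝ M']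

/-- the averaging size `m = |e|sεd(L^k − 1)` of p40's `norm_fTwo_apply_le`. [cite: Balaban1982Higgs1, (3.15) p.614] -/
private theorem m_nonneg {s : ℝ} (hs : 0 ≤ s) : 0 ≤ |C.e| * s * P.mesh 0 * (P.d * ((P.L : ℝ) ^ k - 1)) := by
  have hL1 : (1 : ℝ) ≤ (P.L : ℝ) ^ k := one_le_pow₀ (by exact_mod_cast P.hL)
  have : (0 : ℝ) ≤ (P.L : ℝ) ^ k - 1 := by linarith
  have := P.mesh_pos 0
  positivity

/-- **THE AVERAGING SOURCES OF A REGION THROUGH `T`, BY BLOCK AVERAGES OVER INTERIOR SITES**: under the support hypothesis (`k ≤ K`,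
`sup_b|Ã_b| ≤ s`), `‖T(avgSrc w)‖ ≤ Σ_y m(2+m)·(L^{−kd}Σ_{x∈B^k(ȳ)}W′(x))·κ′_T(y)` with the truncations `W′ = cutV w`, `κ′_T = cutK T`
(r14's `norm_mapE_avgSrc_le_block` with the sum restricted to deep blocks, where the truncations are exact).
[cite: Balaban1982Higgs1, (3.15)–(3.16) pp.614–615] [cite: Balaban1983Higgs3, p.412] -/
theorem norm_mapE_avgSrc_region_le (T : ScalarField P 0 N →ₗ[ℝ] M') (hk : k ≤ P.K) {s : ℝ} (hs : 0 ≤ s)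
    (hA : ∀ b : HiggsLattice.PBond P 0, |A b| ≤ s)
    (hAS : ∀ b : HiggsLattice.PBond P 0, A b ≠ 0 → DeepBlk k K₀ Ω b.src ∧ DeepBlk k K₀ Ω b.tgt) (w : ScalarField P 0 N) :
    ‖T (avgSrc C A B k w)‖
      ≤ ∑ y : HiggsLattice.Site P 0,
          ((|C.e| * s * P.mesh 0 * (P.d * ((P.L : ℝ) ^ k - 1))) * (2 + |C.e| * s * P.mesh 0 * (P.d * ((P.L : ℝ) ^ k - 1))) *
            (((P.L : ℝ) ^ (k * P.d))⁻¹ * ∑ x ∈ blockK k (blockIter k y), cutV k K₀ Ω w x)) *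
          cutK k K₀ Ω T y := by
  set m : ℝ := |C.e| * s * P.mesh 0 * (P.d * ((P.L : ℝ) ^ k - 1)) with hm
  have hm0 : 0 ≤ m := m_nonneg C k hs
  refine (norm_mapE_le_sum_norm_mul_col T _).trans (Finset.sum_le_sum fun y _ => ?_)
  by_cases hy : DeepBlk k K₀ Ω y
  · -- a deep block: every site of it is interior, the truncations are exact
    rw [cutK_of_interior T hy.interior]
    refine mul_le_mul_of_nonneg_right ?_ (Finset.sum_nonneg fun _ _ => norm_nonneg _)
    have hblk : ∑ x ∈ blockK k (blockIter k y), cutV k K₀ Ω w x = ∑ x ∈ blockK k (blockIter k y), ‖w x‖ :=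
      Finset.sum_congr rfl fun x hx => cutV_of_interior w (hy.interior_of_mem_blockK hx)
    rw [hblk]
    set avg : ℝ := ((P.L : ℝ) ^ (k * P.d))⁻¹ * ∑ x ∈ blockK k (blockIter k y), ‖w x‖ with havg
    have hQ : ‖avgQkLin C B k w (blockIter k y)‖ ≤ avg := norm_avgQkLin_apply_le_block C k B w _
    have hF : ‖fTwo C A B k w (blockIter k y)‖ ≤ m * avg := norm_fTwo_apply_le C A B k hk hs hA w _
    rw [avgSrc, Pi.add_apply, Pi.add_apply]
    have e1 : ‖fTwoAdj C A B k (avgQkLin C B k w) y‖ ≤ m * avg :=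
      (norm_fTwoAdj_apply_le C A B k hk hs hA _ y).trans (mul_le_mul_of_nonneg_left hQ hm0)
    have e2 : ‖avgQkAdj C B k (fTwo C A B k w) y‖ ≤ m * avg := by
      rw [B3Ineq210RegularTorus.norm_avgQkAdj_apply']; exact hF
    have e3 : ‖fTwoAdj C A B k (fTwo C A B k w) y‖ ≤ m * (m * avg) :=
      (norm_fTwoAdj_apply_le C A B k hk hs hA _ y).trans (mul_le_mul_of_nonneg_left hF hm0)
    calc ‖fTwoAdj C A B k (avgQkLin C B k w) y + avgQkAdj C B k (fTwo C A B k w) y + fTwoAdj C A B k (fTwo C A B k w) y‖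
        ≤ ‖fTwoAdj C A B k (avgQkLin C B k w) y + avgQkAdj C B k (fTwo C A B k w) y‖ + ‖fTwoAdj C A B k (fTwo C A B k w) y‖ :=
          norm_add_le _ _
      _ ≤ (m * avg + m * avg) + m * (m * avg) := add_le_add ((norm_add_le _ _).trans (add_le_add e1 e2)) e3
      _ = m * (2 + m) * avg := by ring
  · -- not deep: the averaging source vanishes at y
    rw [avgSrc_apply_eq_zero C A B hAS hk hy, norm_zero, zero_mul]
    refine mul_nonneg (mul_nonneg (mul_nonneg hm0 (by linarith)) (mul_nonneg (inv_nonneg.mpr (pow_nonneg (Nat.cast_nonneg _) _))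
      (Finset.sum_nonneg fun _ _ => cutV_nonneg w _))) (cutK_nonneg T y)

/-- **THE L-FORM ROW OF `V_k(Ã,B̃)w` ON A REGION, THROUGH A VECTOR-VALUED LINEAR FUNCTIONAL `T`, TRUNCATED TO THE INTERIOR.**  For a region
`Ω ⊆ T_ε`, a field `Ã = A` with `sup_b|A_b| ≤ s`, (I.2.23)-shape regularity `δ_A` and the SUPPORT HYPOTHESIS `A_b ≠ 0 ⇒ DeepBlk b₋ ∧ DeepBlk b₊`
(print p. 412), `k ≤ K`, and every field `w`:
`‖T(V_k^Ω w)‖ ≤ Σ_b[|e|s·D′(b)κ′_T(b₊) + (ε⁻¹|e|δ_A·W′(b₋) + |e|s·D′(b))κ′_T(b₋) + (|e|s)²W′(b₊)κ′_T(b₊)] + |a_k|(L^kε)^{−2}Σ_y m(2+m)(L^{−kd}Σ_{x∈B^k(ȳ)}W′(x))κ′_T(y)`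
with `W′ = cutV w`, `D′ = cutD w`, `κ′_T = cutK T` (values, derivatives and columns AT INTERIOR POINTS ONLY) — p35's torus row
`B3Op116LeibnizRows.norm_mapE_srcV_le_leibniz` on the region, in the input shape of `B3Op116MajorantStep.row_step_le`.
[cite: Balaban1982Higgs1, (3.16) p.615] [cite: Balaban1983Higgs3, (1.16) p.414, p.412, (2.10) p.426] -/
theorem norm_mapE_srcV_region_le (T : ScalarField P 0 N →ₗ[ℝ] M') (hk : k ≤ P.K) {s δA : ℝ} (hs : 0 ≤ s) (hδA : 0 ≤ δA)
    (hA : ∀ b : HiggsLattice.PBond P 0, |A b| ≤ s)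
    (hregA : ∀ (z : HiggsLattice.Site P 0) (μ ν : Fin P.d), |A ⟨z.shift ν, μ⟩ - A ⟨z, μ⟩| ≤ δA)
    (hAS : ∀ b : HiggsLattice.PBond P 0, A b ≠ 0 → DeepBlk k K₀ Ω b.src ∧ DeepBlk k K₀ Ω b.tgt) (w : ScalarField P 0 N) :
    ‖T (srcV C A B k Ω a w)‖
      ≤ (∑ b : HiggsLattice.PBond P 0,
          (|C.e| * s * cutD k K₀ Ω C B w b * cutK k K₀ Ω T b.tgt
            + ((P.mesh 0)⁻¹ * (|C.e| * δA) * cutV k K₀ Ω w b.src + |C.e| * s * cutD k K₀ Ω C B w b) * cutK k K₀ Ω T b.src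
            + (|C.e| * s) ^ 2 * cutV k K₀ Ω w b.tgt * cutK k K₀ Ω T b.tgt))
        + |B1.aSeq a P.L k| * (P.mesh k)⁻¹ ^ 2 *
            ∑ y : HiggsLattice.Site P 0,
              ((|C.e| * s * P.mesh 0 * (P.d * ((P.L : ℝ) ^ k - 1))) * (2 + |C.e| * s * P.mesh 0 * (P.d * ((P.L : ℝ) ^ k - 1))) *
                (((P.L : ℝ) ^ (k * P.d))⁻¹ * ∑ x ∈ blockK k (blockIter k y), cutV k K₀ Ω w x)) *
              cutK k K₀ Ω T y := by
  have hes : 0 ≤ |C.e| * s := mul_nonneg (abs_nonneg _) hs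
  have hκ₂ : 0 ≤ (P.mesh 0)⁻¹ * (|C.e| * δA) := mul_nonneg (inv_nonneg.mpr (P.mesh_pos 0).le) (mul_nonneg (abs_nonneg _) hδA)
  rw [srcV_region_eq_univ C A B hAS, map_srcV_univ_leibniz]
  refine (norm_sub_le _ _).trans (add_le_add ?_ ?_)
  · rw [norm_neg]
    refine (norm_sum_le _ _).trans (Finset.sum_le_sum fun b _ => ?_)
    by_cases hb : DeepBlk k K₀ Ω b.src
    · -- a deep bond: both endpoints interior, the truncations are exact; FILE 4α's three bounds
      have h1 : Interior k K₀ Ω b.src := hb.interior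
      have h2 : Interior k K₀ Ω b.tgt := hb.interior_shift b.dir
      rw [cutD_of_interior C B w h1, cutV_of_interior w h1, cutV_of_interior w h2, cutK_of_interior T h1, cutK_of_interior T h2]
      refine (norm_add_le _ _).trans (add_le_add ((norm_add_le _ _).trans (add_le_add ?_ ?_)) ?_)
      · exact norm_mapE_srcMD_le C A B T (hA b) w
      · refine (norm_mapE_single_le T b.src _).trans
          (mul_le_mul_of_nonneg_right ?_ (Finset.sum_nonneg fun _ _ => norm_nonneg _))
        refine (norm_sub_le _ _).trans (add_le_add (norm_nMul_apply_le C A hregA b _) ?_)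
        exact (B3Op116Pieces.norm_fOne_apply_le C (P.mesh_pos 0).ne' (A b) _).trans
          (mul_le_mul_of_nonneg_right (mul_le_mul_of_nonneg_left (hA b) (abs_nonneg _)) (norm_nonneg _))
      · exact norm_mapE_srcMM_le C A B T (hA b) w
    · -- not deep: the three charges of the bond vanish
      rw [srcMD_eq_zero C A B (apply_eq_zero_of_not_deep_src A hAS hb), srcMM_eq_zero C A B (apply_eq_zero_of_not_deep_src A hAS hb),
        leibnizCharge_eq_zero C A B hAS hb, Pi.single_zero, map_zero, add_zero, add_zero, norm_zero]
      have hK1 := cutK_nonneg (k := k) (K₀ := K₀) (Ω := Ω) T b.src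
      have hK2 := cutK_nonneg (k := k) (K₀ := K₀) (Ω := Ω) T b.tgt
      have hV1 := cutV_nonneg (k := k) (K₀ := K₀) (Ω := Ω) w b.src
      have hV2 := cutV_nonneg (k := k) (K₀ := K₀) (Ω := Ω) w b.tgt
      have hD := cutD_nonneg (k := k) (K₀ := K₀) (Ω := Ω) C B w b
      positivity
  · rw [norm_smul, Real.norm_eq_abs, abs_mul, abs_of_nonneg (pow_nonneg (inv_nonneg.mpr (P.mesh_pos k).le) 2)]
    exact mul_le_mul_of_nonneg_left (norm_mapE_avgSrc_region_le C A B k T hk hs hA hAS w)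
      (mul_nonneg (abs_nonneg _) (pow_nonneg (inv_nonneg.mpr (P.mesh_pos k).le) 2))

end Row

end Literature.MathematicalPhysics.QuantumFieldTheory.Balaban1983to89.B3Op116RegionSources

end
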